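import Literature.AnabelianGeometry.AbsoluteAnabelian.AbsTopII.EllipticAdmissible
import HarnessLib

/-!
# [AbsTopII] Cor 3.3 (ii) with PRINT-FAITHFUL torsion-freeness — successor right-hand side and
# successor of `Cor_3_3_ii` (finding T1g11-F1)

S. Mochizuki, *Topics in Absolute Anabelian Geometry II: Decomposition Groups and Endomorphisms*
[AbsTopII] (bib `MochizukiAbsTopII2013`; kurims manuscript `paper:url-585b8d0ad0d9`, cell render
`HOME/lit/renders/AbsTopII-kurims-url-585b8d0ad0d9/p0068.txt`), §3, Corollary 3.3 (ii) p. 68: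
"the collection of open subgroups `Π_D ⊆ Π_C` that arise from finite étale double coverings `D → C`
that exhibit `C` as semi-elliptic [cf. Remark 3.1.1] may be characterized 'group-theoretically' as the
collection of open subgroups `J ⊆ Π_C` of index `2` such that `J ∩ Δ_C` [where
`Δ_C := Ker(Π_C ↠ G')`] is torsion-free [i.e., the covering determined by `J` is a scheme — cf.
[AbsTopI], Lemma 4.1, (iv)]."

WHY THIS FILE (cell abc-iut, row «TORSIONFREE-SUCCESSOR», abc-iut-L4-lead m151 (6); seat
abc-iut-L4-t4 gen 12).  FINDING T1g11-F1 (abc-iut-L5-t1; kernel certificates: abc-iut-L5-t1's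
`Literature/GroupTheory/UniqueRootsVersusTorsionFree.lean`, abc-iut-L4-t12's
`Summits/ABC/IUTFork/FreeProfiniteUniqueRootsNoGo.lean`): the landed right-hand side
`semiEllipticDoubleCoverSubgroups` (abc-iut-L4-t6, `EllipticAdmissible.lean`) renders "torsion-free"
by Mathlib's class `IsMulTorsionFree` — "`x ↦ xⁿ` injective for every `n ≠ 0`", i.e. UNIQUE ROOTS —
which agrees with print's "no nontrivial element of finite order" only for commutative groups
(Mathlib `isMulTorsionFree_iff_not_isOfFinOrder` is stated under `[CommGroup]`); a free pro-`Σ`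
group of rank `≥ 2` with `2, 3 ∈ Σ` (the `Δ` of a once-punctured elliptic curve) is torsion-free but
NOT `IsMulTorsionFree` (`Summit.ABC.IUTFork.not_isMulTorsionFree_of_isFreeProOn`), so the landed
RHS is EMPTY at genuine data and `Cor_3_3_ii` is false there as typed.  DEFS-freeze: no landed
declaration is edited.  This file mints the print-faithful SUCCESSORS, in the cell's established
currency «`∀ g, IsOfFinOrder g → g = 1`» (15 tree files, e.g. `IsFreeProOn.torsionFree`;
abc-iut-L5-t1's `htf⁰`/`huniq⁰` binders in `PuncturedEllipticCoveringsCor12TorsionFreeFaithful`):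
* `semiEllipticDoubleCoverSubgroupsTF C` — open, index `2`, `J ∩ Δ_C` without nontrivial elements
  of finite order;
* the one-way bridge `semiEllipticDoubleCoverSubgroups_subset_TF` (unique roots ⇒ torsion-free,
  Mathlib `IsOfFinOrder.eq_one'`), and `semiEllipticDoubleCoverSubgroupsTF_eq_of_comm` (for an
  ABELIAN `Δ_C` the two sets coincide — so landed model witnesses with abelian `Δ` transfer);
* `inf_geom_torsionFree_of_geom` — if `Δ_C` is torsion-free then so is every `J ∩ Δ_C` (with
  `IsFreeProOn.torsionFree` this is the SEPARATION at the [AbsTopII] site: the TF clause holds at a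
  free pro-`Σ` `Δ_C`, where the unique-roots clause fails);
* `IsogenyModel.ellipticDoubleCoverImages` (the left-hand side of `Cor_3_3_ii`, named) and the
  successor named fact `Cor_3_3_iiTF` (same left-hand side, print-faithful right-hand side), with
  `cor_3_3_ii_iff`, `Cor_3_3_ii.lhs_subset_TF`, `cor_3_3_iiTF_iff_of_comm`.

HONEST FRAMING: statements about OUR typing; the successor is an unproved named fact exactly like
its predecessor (FACT-LIST F-0234's successor-of-record is the L4-lead's booking, not this file's
claim); nothing here bears on [IUTchIII] Cor 3.12 or asserts that abc is proved or refuted.  No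
instance, no notation; axioms standard.
-/

namespace Literature.AnabelianGeometry.AbsoluteAnabelian.AbsTopII

open FundamentalExtension

universe u

/-! ### The print-faithful right-hand side -/

/-- **Cor 3.3 (ii) p. 68, the group-theoretic side, PRINT-FAITHFUL**: "the collection of open
subgroups `J ⊆ Π_C` of index `2` such that `J ∩ Δ_C` [where `Δ_C := Ker(Π_C ↠ G')`] is torsion-free
[i.e., the covering determined by `J` is a scheme — cf. [AbsTopI], Lemma 4.1, (iv)]" — torsion-free
= NO NONTRIVIAL ELEMENT OF FINITE ORDER (successor of abc-iut-L4-t6's `semiEllipticDoubleCoverSubgroups`,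
which uses Mathlib's unique-roots class `IsMulTorsionFree`; finding T1g11-F1).
[cite: MochizukiAbsTopII2013, Cor 3.3 (ii) p.68] -/
def semiEllipticDoubleCoverSubgroupsTF (C : FundamentalExtension.{u}) : Set (Subgroup C.arith) :=
  {J | IsOpen (J : Set C.arith) ∧ J.index = 2 ∧ ∀ g : ↥(J ⊓ C.geom), IsOfFinOrder g → g = 1}

variable {C : FundamentalExtension.{u}}

/-- Membership in the print-faithful right-hand side, unfolded.
[cite: MochizukiAbsTopII2013, Cor 3.3 (ii) p.68] -/
theorem mem_semiEllipticDoubleCoverSubgroupsTF_iff {J : Subgroup C.arith} :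
    J ∈ semiEllipticDoubleCoverSubgroupsTF C ↔
      IsOpen (J : Set C.arith) ∧ J.index = 2 ∧ ∀ g : ↥(J ⊓ C.geom), IsOfFinOrder g → g = 1 :=
  Iff.rfl

/-- The torsion-freeness clause in MEMBERSHIP form (the shape of `ProfiniteFiniteNormalTorsionFree`):
"no nontrivial element of `J ∩ Δ_C` has finite order". [cite: MochizukiAbsTopII2013, Cor 3.3 (ii) p.68] -/
theorem inf_geom_torsionFree_iff_forall_mem {J : Subgroup C.arith} :
    (∀ g : ↥(J ⊓ C.geom), IsOfFinOrder g → g = 1) ↔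
      ∀ g ∈ J ⊓ C.geom, IsOfFinOrder g → g = 1 := by
  constructor
  · intro h g hg hfin
    have h1 := h ⟨g, hg⟩ (((J ⊓ C.geom).subtype_injective).isOfFinOrder_iff.mp hfin)
    exact congrArg Subtype.val h1
  · intro h g hfin
    exact Subtype.ext (h g g.2 ((J ⊓ C.geom).subtype.isOfFinOrder hfin))

/-! ### Bridges between the two renderings -/

/-- **Unique roots ⇒ torsion-free** (Mathlib `IsOfFinOrder.eq_one'`): the landed clause
`IsMulTorsionFree ↥(J ⊓ Δ_C)` implies the print-faithful one.
[cite: MochizukiAbsTopII2013, Cor 3.3 (ii) p.68] -/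
theorem inf_geom_torsionFree_of_isMulTorsionFree {J : Subgroup C.arith}
    (h : IsMulTorsionFree ↥(J ⊓ C.geom)) : ∀ g : ↥(J ⊓ C.geom), IsOfFinOrder g → g = 1 :=
  fun _ hg => hg.eq_one'

/-- **One-way bridge**: the landed right-hand side is contained in the print-faithful one
(`semiEllipticDoubleCoverSubgroups C ⊆ semiEllipticDoubleCoverSubgroupsTF C`).
[cite: MochizukiAbsTopII2013, Cor 3.3 (ii) p.68] -/
theorem semiEllipticDoubleCoverSubgroups_subset_TF (C : FundamentalExtension.{u}) :
    semiEllipticDoubleCoverSubgroups C ⊆ semiEllipticDoubleCoverSubgroupsTF C :=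
  fun _ ⟨hopen, hindex, htf⟩ => ⟨hopen, hindex, inf_geom_torsionFree_of_isMulTorsionFree htf⟩

/-- For a COMMUTATIVE `J ∩ Δ_C` the two renderings agree: torsion-free ⇒ unique roots (if
`aⁿ = bⁿ` then `(a b⁻¹)ⁿ = 1`). [cite: MochizukiAbsTopII2013, Cor 3.3 (ii) p.68] -/
theorem isMulTorsionFree_of_torsionFree_of_comm {G : Type u} [Group G]
    (hcomm : ∀ a b : G, a * b = b * a) (htf : ∀ g : G, IsOfFinOrder g → g = 1) :
    IsMulTorsionFree G := by
  refine ⟨fun n hn a b hab => ?_⟩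
  have hc : Commute a b⁻¹ := hcomm a b⁻¹
  have hpow : (a * b⁻¹) ^ n = 1 := by
    rw [hc.mul_pow, inv_pow]
    have hab' : a ^ n = b ^ n := hab
    rw [hab', mul_inv_cancel]
  have hfin : IsOfFinOrder (a * b⁻¹) :=
    isOfFinOrder_iff_pow_eq_one.mpr ⟨n, Nat.pos_of_ne_zero hn, hpow⟩
  exact mul_inv_eq_one.mp (htf _ hfin)

/-- If `Δ_C` is ABELIAN, the print-faithful clause for `J ∩ Δ_C` implies the landed unique-roots
clause. [cite: MochizukiAbsTopII2013, Cor 3.3 (ii) p.68] -/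
theorem isMulTorsionFree_inf_geom_of_comm (hΔ : ∀ x ∈ C.geom, ∀ y ∈ C.geom, x * y = y * x)
    {J : Subgroup C.arith} (htf : ∀ g : ↥(J ⊓ C.geom), IsOfFinOrder g → g = 1) :
    IsMulTorsionFree ↥(J ⊓ C.geom) :=
  isMulTorsionFree_of_torsionFree_of_comm
    (fun a b => Subtype.ext (hΔ a (Subgroup.mem_inf.mp a.2).2 b (Subgroup.mem_inf.mp b.2).2)) htf

/-- **For an ABELIAN `Δ_C` the two right-hand sides COINCIDE** — so every landed model witness whose
`Δ` is abelian (or trivial) is at once a witness for the successor.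
[cite: MochizukiAbsTopII2013, Cor 3.3 (ii) p.68] -/
theorem semiEllipticDoubleCoverSubgroupsTF_eq_of_comm (C : FundamentalExtension.{u})
    (hΔ : ∀ x ∈ C.geom, ∀ y ∈ C.geom, x * y = y * x) :
    semiEllipticDoubleCoverSubgroupsTF C = semiEllipticDoubleCoverSubgroups C := by
  refine Set.Subset.antisymm ?_ (semiEllipticDoubleCoverSubgroups_subset_TF C)
  rintro J ⟨hopen, hindex, htf⟩
  exact ⟨hopen, hindex, isMulTorsionFree_inf_geom_of_comm hΔ htf⟩

/-! ### Satisfiability of the print-faithful clause -/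

/-- **If `Δ_C` is torsion-free, so is every `J ∩ Δ_C`.**  With abc-iut-L4's
`IsFreeProOn.torsionFree` (`FreeProSigmaTorsionFree.lean`) this is the SEPARATION at the
[AbsTopII] site: at a free pro-`Σ` `Δ_C` of rank `≥ 2`, `2, 3 ∈ Σ`, the print-faithful clause HOLDS
for every `J`, whereas the unique-roots clause FAILS
(`Summit.ABC.IUTFork.not_mem_semiEllipticDoubleCoverSubgroups_of_isFreeProOn`).
[cite: MochizukiAbsTopII2013, Cor 3.3 (ii) p.68] -/
theorem inf_geom_torsionFree_of_geom (hΔ : ∀ g : ↥C.geom, IsOfFinOrder g → g = 1)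
    (J : Subgroup C.arith) : ∀ g : ↥(J ⊓ C.geom), IsOfFinOrder g → g = 1 := by
  intro g hfin
  have hmem : (g : C.arith) ∈ C.geom := (Subgroup.mem_inf.mp g.2).2
  have h1 : IsOfFinOrder (g : C.arith) := (J ⊓ C.geom).subtype.isOfFinOrder hfin
  have h2 : IsOfFinOrder (⟨g, hmem⟩ : ↥C.geom) :=
    (C.geom.subtype_injective).isOfFinOrder_iff.mp h1
  have h3 : ((⟨g, hmem⟩ : ↥C.geom) : C.arith) = ((1 : ↥C.geom) : C.arith) :=
    congrArg Subtype.val (hΔ _ h2)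
  exact Subtype.ext h3

/-- Hence, at a torsion-free `Δ_C`, EVERY open subgroup of index `2` lies in the print-faithful
right-hand side. [cite: MochizukiAbsTopII2013, Cor 3.3 (ii) p.68] -/
theorem mem_semiEllipticDoubleCoverSubgroupsTF_of_geom_torsionFree
    (hΔ : ∀ g : ↥C.geom, IsOfFinOrder g → g = 1) {J : Subgroup C.arith}
    (hopen : IsOpen (J : Set C.arith)) (hindex : J.index = 2) :
    J ∈ semiEllipticDoubleCoverSubgroupsTF C :=
  ⟨hopen, hindex, inf_geom_torsionFree_of_geom hΔ J⟩

/-! ### The successor of `Cor_3_3_ii` (model-relative, special case `Π = π₁`) -/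

namespace IsogenyModel

variable (M : IsogenyModel.{u})

/-- The LEFT-hand side of Cor 3.3 (ii) in the model: "the collection of open subgroups `Π_D ⊆ Π_C`
that arise from finite étale double coverings `D → C` that exhibit `C` as semi-elliptic" — the images
`Π_D` of the degree-`2` coverings over `k` by once-punctured elliptic curves (the set literal of
abc-iut-L4-t6's `Cor_3_3_ii`, named). [cite: MochizukiAbsTopII2013, Cor 3.3 (ii) p.68] -/
def ellipticDoubleCoverImages (C : M.Curve) : Set (Subgroup (M.ext C).arith) :=
  {J | ∃ (D : M.Curve) (f : M.FinEt D C), M.IsOver f ∧ M.IsOncePuncturedElliptic D ∧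
      M.degree f = 2 ∧ J = M.arithImage f}

end IsogenyModel

/-- `Cor_3_3_ii` unfolded through the named left-hand side.
[cite: MochizukiAbsTopII2013, Cor 3.3 (ii) p.68] -/
theorem cor_3_3_ii_iff (M : IsogenyModel.{u}) :
    Cor_3_3_ii M ↔ ∀ C : M.Curve, M.IsSemiElliptic C →
      M.ellipticDoubleCoverImages C = semiEllipticDoubleCoverSubgroups (M.ext C) :=
  Iff.rfl

/-- **Corollary 3.3 (ii)** p. 68, model-relative, special case `Π = π₁`, PRINT-FAITHFUL successor of
`Cor_3_3_ii` (finding T1g11-F1): for a semi-elliptic `C`, "the collection of open subgroups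
`Π_D ⊆ Π_C` that arise from finite étale double coverings `D → C` that exhibit `C` as semi-elliptic
[cf. Remark 3.1.1] may be characterized 'group-theoretically' as" `semiEllipticDoubleCoverSubgroupsTF
(π₁(C) ↠ G)`.  -- TODO(general form): arbitrary GSAFG-type quotients `π₁ ↠ Π` with `([X],[k],Σ) ∈ 𝒟`,
as for the predecessor. [cite: MochizukiAbsTopII2013, Cor 3.3 (ii) p.68] -/
def Cor_3_3_iiTF (M : IsogenyModel.{u}) : Prop :=
  ∀ C : M.Curve, M.IsSemiElliptic C →
    M.ellipticDoubleCoverImages C = semiEllipticDoubleCoverSubgroupsTF (M.ext C)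

/-- What the landed `Cor_3_3_ii` still gives for the successor: the (⊆) half — every `Π_D` of a
genuine double covering lies in the print-faithful right-hand side.
[cite: MochizukiAbsTopII2013, Cor 3.3 (ii) p.68] -/
theorem Cor_3_3_ii.lhs_subset_TF {M : IsogenyModel.{u}} (h : Cor_3_3_ii M) (C : M.Curve)
    (hC : M.IsSemiElliptic C) :
    M.ellipticDoubleCoverImages C ⊆ semiEllipticDoubleCoverSubgroupsTF (M.ext C) := by
  have h1 : M.ellipticDoubleCoverImages C = semiEllipticDoubleCoverSubgroups (M.ext C) := h C hC
  rw [h1]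
  exact semiEllipticDoubleCoverSubgroups_subset_TF (M.ext C)

/-- At models whose `Δ_C` (for semi-elliptic `C`) is ABELIAN the successor and the predecessor are
EQUIVALENT (the two right-hand sides coincide). [cite: MochizukiAbsTopII2013, Cor 3.3 (ii) p.68] -/
theorem cor_3_3_iiTF_iff_of_comm {M : IsogenyModel.{u}}
    (hΔ : ∀ C : M.Curve, M.IsSemiElliptic C →
      ∀ x ∈ (M.ext C).geom, ∀ y ∈ (M.ext C).geom, x * y = y * x) :
    Cor_3_3_iiTF M ↔ Cor_3_3_ii M := by
  refine forall_congr' fun C => forall_congr' fun hC => ?_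
  rw [semiEllipticDoubleCoverSubgroupsTF_eq_of_comm (M.ext C) (hΔ C hC)]
  rfl

end Literature.AnabelianGeometry.AbsoluteAnabelian.AbsTopII
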